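import Summits.QuantumFields.YangMills.Theorems.F4SubCurvatureDoorForwardConeLukacsOneDim
import Summits.QuantumFields.YangMills.Theorems.F4SubCurvatureDoorLaplaceFourierRegistered
import Mathlib
import HarnessLib

/-!
# «Multivariate Lukacs» half of rung R-S1a `SpatialExponentialMoments` (S1 programme, crux ⟨stmt-QuantumFields-23125⟩)

Free-hands helper of width seat `ym-line-sfw-p2-w3` (g37, cell `ym-idea-1`).  The owner's rung R-S1a (`ForwardConeRungs.SpatialExponentialMoments`,
`Cruxes/RationalToGeneral/Lines/forward_cone_rungs.lean`) is «cross theorem at the time axis + multivariate Lukacs»: analyticity of the spatial slice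
`x⃗ ↦ K(t, x⃗) = ∫ e^{−tE} cos(q⃗·x⃗) dμ` at `x⃗ = 0` should give a spatial exponential moment `∫ e^{−tE + δ|q⃗|} dμ < ∞`.  This file proves exactly
that implication (`exists_spatialExpMoment_of_analyticAt`), reducing R-S1a to the analyticity input (`CrossAnalyticity ∘ DirectionalExtension`, other
seats): restrict to the three coordinate axes, push `e^{−tE} dμ` forward to `ℝ`, apply the one-dimensional Lukacs theorem
`exists_expMoment_of_analyticAt_cosTransform` (rung R-S1ℓ, file `…ForwardConeLukacsOneDim.lean`) in each direction, and recombine with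
`|q⃗| ≤ Σ_j |q_j|` and `xyz ≤ (x³ + y³ + z³)/3` (both inlined).

HONEST LABEL: elementary reduction toward an OPEN rung; S1, ⟨23125⟩, ⟨23035⟩ and R2d stay OPEN; the Yang–Mills mass gap is NOT proved.
-/

set_option autoImplicit false

noncomputable section

namespace Summit.QuantumFields.YangMills.Theorems.F4SubCurvatureDoorForwardConeLukacs

open Finset MeasureTheory Filter
open scoped BigOperators Real Topology ENNReal
open Summit.QuantumFields.YangMills.Theorems.F4SubCurvatureDoorLaplaceFourierRegistered (E3)

/-- `e^{δ(a+b+c)} ≤ (e^{3δa} + e^{3δb} + e^{3δc})/3` (AM–GM for three terms; the cubic AM–GM `xyz ≤ (x³+y³+z³)/3` is inlined — it is also the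
tree's `…FouriersLaw…ChainVariation.mul_mul_le_add_pow_three`). -/
theorem exp_mul_add_three_le (δ a b c : ℝ) :
    Real.exp (δ * (a + b + c)) ≤ (Real.exp (3 * δ * a) + Real.exp (3 * δ * b) + Real.exp (3 * δ * c)) / 3 := by
  have amgm : ∀ x y z : ℝ, 0 ≤ x → 0 ≤ y → 0 ≤ z → x * y * z ≤ (x ^ 3 + y ^ 3 + z ^ 3) / 3 := by
    intro x y z hx hy hz
    have key : x ^ 3 + y ^ 3 + z ^ 3 - 3 * (x * y * z) = (x + y + z) * ((x - y) ^ 2 + (y - z) ^ 2 + (z - x) ^ 2) / 2 := by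
      ring
    have hnn : 0 ≤ (x + y + z) * ((x - y) ^ 2 + (y - z) ^ 2 + (z - x) ^ 2) / 2 := by positivity
    linarith
  have h := amgm _ _ _ (Real.exp_pos (δ * a)).le (Real.exp_pos (δ * b)).le (Real.exp_pos (δ * c)).le
  rw [← Real.exp_add, ← Real.exp_add] at h
  have e3 : ∀ u : ℝ, Real.exp (δ * u) ^ 3 = Real.exp (3 * δ * u) := fun u => by
    rw [← Real.exp_nat_mul]; push_cast; ring_nf
  rw [e3, e3, e3, show δ * a + δ * b + δ * c = δ * (a + b + c) by ring] at h
  exact h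

/-- **Multivariate Lukacs (reduction of R-S1a to analyticity).**  Let `μ` be a measure on `ℝ × E3` with `e^{−tE}` integrable and let
`F(z) = ∫ e^{−tE} cos⟨q⃗, z⟩ dμ` be real-analytic at `z = 0`.  Then `∫ e^{−tE + δ|q⃗|} dμ < ∞` for some `δ > 0`. -/
theorem exists_spatialExpMoment_of_analyticAt (μ : Measure (ℝ × E3)) (t : ℝ)
    (hInt : Integrable (fun p : ℝ × E3 => Real.exp (-(t * p.1))) μ) (F : E3 → ℝ)
    (hF : ∀ z : E3, F z = ∫ p : ℝ × E3, Real.exp (-(t * p.1)) * Real.cos (inner ℝ p.2 z) ∂μ) (hA : AnalyticAt ℝ F 0) :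
    ∃ δ : ℝ, 0 < δ ∧ Integrable (fun p : ℝ × E3 => Real.exp (-(t * p.1) + δ * ‖p.2‖)) μ := by
  -- the weight `w = e^{−tE}` and the weighted measure `ν = w dμ`
  set w : ℝ × E3 → ℝ := fun p => Real.exp (-(t * p.1)) with hw_def
  have hw_cont : Continuous w := by
    simp only [hw_def]
    fun_prop
  have hw_meas : Measurable (fun p : ℝ × E3 => ENNReal.ofReal (w p)) := hw_cont.measurable.ennreal_ofReal
  have hw_pos : ∀ p, 0 < w p := fun p => Real.exp_pos _
  set ν : Measure (ℝ × E3) := μ.withDensity (fun p => ENNReal.ofReal (w p)) with hν_def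
  haveI : IsFiniteMeasure ν := isFiniteMeasure_withDensity_ofReal hInt.2
  -- marginals and transfer
  have hπ_cont : ∀ j : Fin 3, Continuous (fun p : ℝ × E3 => p.2 j) := fun j => by fun_prop
  have hsmul : ∀ (j : Fin 3) (f : ℝ → ℝ),
      (fun p : ℝ × E3 => (ENNReal.ofReal (w p)).toReal • (f ∘ fun p : ℝ × E3 => p.2 j) p) = fun p => w p * f (p.2 j) :=
    fun j f => by
      funext p
      rw [ENNReal.toReal_ofReal (hw_pos p).le, smul_eq_mul, Function.comp_apply]
  have htrans_int : ∀ (j : Fin 3) (f : ℝ → ℝ), Continuous f →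
      (Integrable f (ν.map fun p : ℝ × E3 => p.2 j) ↔ Integrable (fun p : ℝ × E3 => w p * f (p.2 j)) μ) := by
    intro j f hf
    rw [integrable_map_measure hf.aestronglyMeasurable (hπ_cont j).measurable.aemeasurable, hν_def,
      integrable_withDensity_iff_integrable_smul' hw_meas (ae_of_all _ fun _ => ENNReal.ofReal_lt_top), hsmul]
  have htrans_val : ∀ (j : Fin 3) (f : ℝ → ℝ), Continuous f →
      ∫ q, f q ∂(ν.map fun p : ℝ × E3 => p.2 j) = ∫ p, w p * f (p.2 j) ∂μ := by
    intro j f hf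
    rw [integral_map (hπ_cont j).measurable.aemeasurable hf.aestronglyMeasurable, hν_def,
      integral_withDensity_eq_integral_toReal_smul hw_meas (ae_of_all _ fun _ => ENNReal.ofReal_lt_top)]
    refine integral_congr_ae (ae_of_all _ fun p => ?_)
    simp only
    rw [ENNReal.toReal_ofReal (hw_pos p).le, smul_eq_mul]
  -- one-dimensional Lukacs in each coordinate direction
  have hdir : ∀ j : Fin 3, ∃ δ : ℝ, 0 < δ ∧ Integrable (fun p : ℝ × E3 => w p * Real.exp (δ * |p.2 j|)) μ := by
    intro j
    haveI : IsFiniteMeasure (ν.map fun p : ℝ × E3 => p.2 j) := by infer_instance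
    set e : E3 := EuclideanSpace.single j (1 : ℝ) with he_def
    set φ : ℝ → ℝ := fun s => ∫ q, Real.cos (s * q) ∂(ν.map fun p : ℝ × E3 => p.2 j) with hφ_def
    -- `φ s = F (s • e_j)`
    have hφF : φ = F ∘ fun s : ℝ => s • e := by
      funext s
      rw [Function.comp_apply, hF, hφ_def]
      simp only
      rw [htrans_val j (fun q => Real.cos (s * q)) (by fun_prop)]
      refine integral_congr_ae (ae_of_all _ fun p => ?_)
      simp only
      rw [inner_smul_right, he_def, EuclideanSpace.inner_single_right]
      simp [hw_def]
    have hφA : AnalyticAt ℝ φ 0 := by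
      rw [hφF]
      exact hA.comp_of_eq (analyticAt_id.smul analyticAt_const) (by simp)
    obtain ⟨δ, hδ, hI⟩ := exists_expMoment_of_analyticAt_cosTransform (ν.map fun p : ℝ × E3 => p.2 j) φ (fun s => rfl) hφA
    exact ⟨δ, hδ, (htrans_int j _ (by fun_prop)).1 hI⟩
  choose δs hδs hIs using hdir
  -- `δ = min_j δ_j / 3`
  set δ₀ : ℝ := min (δs 0) (min (δs 1) (δs 2)) with hδ₀_def
  have hδ₀ : 0 < δ₀ := lt_min (hδs 0) (lt_min (hδs 1) (hδs 2))
  have hδ₀le : ∀ j : Fin 3, δ₀ ≤ δs j := by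
    intro j
    fin_cases j
    · exact min_le_left _ _
    · exact (min_le_right _ _).trans (min_le_left _ _)
    · exact (min_le_right _ _).trans (min_le_right _ _)
  refine ⟨δ₀ / 3, by positivity, ?_⟩
  -- domination by `(1/3) Σ_j w e^{δ_j |q_j|}`
  have hbound_int : Integrable (fun p : ℝ × E3 =>
      (w p * Real.exp (δs 0 * |p.2 0|) + w p * Real.exp (δs 1 * |p.2 1|) + w p * Real.exp (δs 2 * |p.2 2|)) / 3) μ :=
    (((hIs 0).add (hIs 1)).add (hIs 2)).div_const 3
  refine hbound_int.mono' (Continuous.aestronglyMeasurable (by fun_prop)) (ae_of_all _ fun p => ?_)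
  rw [Real.norm_eq_abs, abs_of_pos (Real.exp_pos _), Real.exp_add]
  -- `|q⃗| ≤ |q₀| + |q₁| + |q₂|` (inlined; cf. `Literature…LegendrianDarboux.DarbouxData.norm_le_sum_abs`)
  have hq : ‖p.2‖ ≤ |p.2 0| + |p.2 1| + |p.2 2| := by
    rw [EuclideanSpace.norm_eq, Fin.sum_univ_three]
    simp only [Real.norm_eq_abs]
    have h0 := abs_nonneg (p.2 0); have h1 := abs_nonneg (p.2 1); have h2 := abs_nonneg (p.2 2)
    calc Real.sqrt (|p.2 0| ^ 2 + |p.2 1| ^ 2 + |p.2 2| ^ 2) ≤ Real.sqrt ((|p.2 0| + |p.2 1| + |p.2 2|) ^ 2) :=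
          Real.sqrt_le_sqrt (by nlinarith)
      _ = |p.2 0| + |p.2 1| + |p.2 2| := Real.sqrt_sq (by positivity)
  have h1 : Real.exp (δ₀ / 3 * ‖p.2‖) ≤ Real.exp (δ₀ / 3 * (|p.2 0| + |p.2 1| + |p.2 2|)) :=
    Real.exp_le_exp.2 (mul_le_mul_of_nonneg_left hq (by positivity))
  have h2 := exp_mul_add_three_le (δ₀ / 3) |p.2 0| |p.2 1| |p.2 2|
  have h3 : ∀ j : Fin 3, Real.exp (3 * (δ₀ / 3) * |p.2 j|) ≤ Real.exp (δs j * |p.2 j|) := fun j =>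
    Real.exp_le_exp.2 (by rw [show 3 * (δ₀ / 3) = δ₀ by ring]; exact mul_le_mul_of_nonneg_right (hδ₀le j) (abs_nonneg _))
  have hw0 := (hw_pos p).le
  have h4 := h3 0; have h5 := h3 1; have h6 := h3 2
  have : w p * Real.exp (δ₀ / 3 * ‖p.2‖) ≤
      w p * ((Real.exp (δs 0 * |p.2 0|) + Real.exp (δs 1 * |p.2 1|) + Real.exp (δs 2 * |p.2 2|)) / 3) :=
    mul_le_mul_of_nonneg_left (h1.trans (h2.trans (by linarith))) hw0
  linarith

end Summit.QuantumFields.YangMills.Theorems.F4SubCurvatureDoorForwardConeLukacs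

end
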